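import Summits.KontsevichZagierPeriods.KontsevichZagierPeriods.Theorems.FurushoPentagonPentagonInKZPathFamilies
import Summits.KontsevichZagierPeriods.KontsevichZagierPeriods.Theorems.FurushoPentagonPentagonInKZCornersCubicalTransport

/-!
# `PentagonInKZ` — stub `stub_cornersCubical`: sides of a corner chart given by a partial
letter map (aux)

A side of a corner chart is described by a partial letter map `pl : ι → Option κ` to the atlas
alphabet (`none` = dead letter of density `0`, `some b` = live letter with the atlas density
`1/(t - σ b)`).  From such data: existence of the side family of absolutely convergent iterated
integrals as KZ representations (`exists_sideFamily`, via the `PathFamilies` toolkit), and the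
side transport of the end-regularised series onto the atlas path with merged residues
(`side_transport_pl`).  Plus the two rows of atlas poles used by the cubical charts.
-/

noncomputable section

open Literature.NumberTheory.Transcendental

namespace Summit.KontsevichZagierPeriods.FurushoPentagon.PentagonInKZ

namespace CornersCubical

/-! ### Sides given by a partial letter map `pl : ι → Option κ` -/

section Partial

variable {R : Type} [CommRing R] [Algebra ℚ R] {A : Type} [Ring A] [Algebra R A]

/-- **Existence of the side families.** If every letter density on a side of length `β ≤ 1`
(`β ∈ ℚ`) is `0` (dead letter, `pl i = none`) or `1/(t - σ b)` (`pl i = some b`) for a row of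
rational poles `σ`, each `0` or separated from `(0, β)`, with pole `0` only over the regularised
letter `x`, then the iterated integrals along the side over words not ending in `x` are KZ
representations (open simplex of side `β`, product integrand; absolutely convergent since the
innermost pole is not `0`, junk integrand `0` on dead words). [cite: KontsevichZagier2001, §1.1] -/
theorem exists_sideFamily {ι κ : Type} (β : ℝ) (hβq : ∃ q : ℚ, β = q) (hβ1 : β ≤ 1)
    (σ : κ → ℝ) (y : κ) (hσq : ∀ b, ∃ q : ℚ, σ b = q) (hσ0 : ∀ b, b ≠ y → σ b ≠ 0)
    (hsep : ∀ b, σ b = 0 ∨ ∀ s : ℝ, 0 < s → s < β → 2⁻¹ ≤ |s - σ b|)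
    (dens : ι → ℝ → ℝ) (pl : ι → Option κ) (x : ι) (hfib : ∀ i, pl i = some y → i = x)
    (hpl : ∀ i s, 0 < s → s < β → dens i s = (pl i).elim 0 fun b => 1 / (s - σ b)) :
    ∃ I : (w : List ι) → KZ.IntegralRep w.length, ∀ w : List ι, w.getLast? ≠ some x →
      (I w).domain = {t | (∀ i, 0 < t i ∧ t i < β) ∧ StrictAnti t} ∧
      Set.EqOn (I w).integrand (fun t => ∏ i, dens (w.get i) (t i)) (I w).domain := by
  classical
  have hdom : ∀ n, Literature.ModelTheory.ExponentialFields.IsSemialgebraic ℚ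
      {t : Fin n → ℝ | (∀ i, 0 < t i ∧ t i < β) ∧ StrictAnti t} :=
    fun n => PathFamilies.isSemialgebraic_simplex hβ1 hβq n
  -- the pole of a letter (junk `0` for dead letters)
  set σ' : ι → ℝ := fun i => (pl i).elim 0 σ with hσ'
  have hσ'q : ∀ i, ∃ q : ℚ, σ' i = q := fun i => by
    cases h : pl i with
    | none => exact ⟨0, by simp [hσ', h]⟩
    | some b => simpa [hσ', h] using hσq b
  have hσ'sep : ∀ i, σ' i = 0 ∨ ∀ s : ℝ, 0 < s → s < β → 2⁻¹ ≤ |s - σ' i| := fun i => by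
    cases h : pl i with
    | none => exact Or.inl (by simp [hσ', h])
    | some b => simpa [hσ', h] using hsep b
  have live : ∀ w : List ι, (∀ i ∈ w, pl i ≠ none) → w.getLast? ≠ some x →
      ∃ r : KZ.IntegralRep w.length,
        r.domain = {t | (∀ i, 0 < t i ∧ t i < β) ∧ StrictAnti t} ∧
        r.integrand = fun t => ∏ i, 1 / (t i - σ' (w.get i)) := by
    intro w hw hx
    refine ⟨⟨_, _, hdom _, PathFamilies.isSemialgebraicFunOn_prodInv (hdom _)
      (fun i => σ' (w.get i)) (fun i => hσ'q _) fun t ht i =>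
        PathFamilies.sub_pole_ne_zero (hσ'sep _) (ht.1 i).1 (ht.1 i).2,
      PathFamilies.integrableOn_prodInv hβ1 (fun i => σ' (w.get i)) (fun i => hσ'sep _)
        fun hn => ?_⟩, rfl, rfl⟩
    set i₀ : ι := w.get ⟨w.length - 1, Nat.sub_one_lt_of_lt hn⟩ with hi₀
    have hmem : i₀ ∈ w := List.get_mem _ _
    obtain ⟨b, hb⟩ := Option.ne_none_iff_exists'.mp (hw i₀ hmem)
    have hlast : w.getLast? = some i₀ := by
      rw [List.getLast?_eq_getElem?, List.getElem?_eq_getElem (by omega)]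
      simp [hi₀, List.get_eq_getElem]
    have hby : b ≠ y := fun hby => hx (by rw [hlast, hfib i₀ (hby ▸ hb)])
    simp only [hσ', hb, Option.elim_some]
    exact hσ0 b hby
  choose rl hrl using live
  choose rz hrz using fun w : List ι => KZ.exists_zeroRep (hdom w.length)
  refine ⟨fun w => if h : (∀ i ∈ w, pl i ≠ none) ∧ w.getLast? ≠ some x then rl w h.1 h.2
    else rz w, fun w hx => ?_⟩
  dsimp only
  by_cases hw : ∀ i ∈ w, pl i ≠ none
  · rw [dif_pos ⟨hw, hx⟩]
    refine ⟨(hrl w hw hx).1, fun t ht => ?_⟩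
    rw [(hrl w hw hx).2]
    rw [(hrl w hw hx).1] at ht
    refine Finset.prod_congr rfl fun i _ => ?_
    obtain ⟨b, hb⟩ := Option.ne_none_iff_exists'.mp (hw _ (List.get_mem w i))
    rw [hpl _ _ (ht.1 i).1 (ht.1 i).2, hb, hσ']
    change 1 / (t i - (pl (w.get i)).elim 0 σ) = 1 / (t i - σ b)
    rw [hb]
    rfl
  · rw [dif_neg (fun h => hw h.1)]
    refine ⟨(hrz w).1, fun t ht => ?_⟩
    rw [(hrz w).1] at ht
    push Not at hw
    obtain ⟨i, hiw, hi⟩ := hw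
    obtain ⟨j, hj⟩ := List.mem_iff_get.mp hiw
    rw [(hrz w).2, Pi.zero_apply]
    symm
    refine Finset.prod_eq_zero (Finset.mem_univ j) ?_
    rw [hj, hpl _ _ (ht.1 j).1 (ht.1 j).2, hi]
    rfl

/-- **The side transport for a partial letter map.** A side of a corner chart whose letter
densities are `0` (dead, `pl i = none`) or the atlas densities `1/(t - σ b)` (`pl i = some b`),
with the regularised letter `x` the only letter over the atlas' regularised letter `y`: the
end-regularised series of the side evaluated at `v` equals the atlas series evaluated at the
merged residues `b ↦ Σ_{pl i = some b} v i`. [cite: Drinfeld1991, §2] -/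
theorem side_transport_pl (χ : KZ.FormalRep →+ R) (hrel : ∀ c ∈ KZ.relations, χ c = 0)
    {ι κ : Type} [Fintype ι] [DecidableEq ι] [Fintype κ] [DecidableEq κ]
    (β : ℝ) (dens : ι → ℝ → ℝ) (σ : κ → ℝ) (x : ι) (y : κ) (pl : ι → Option κ)
    (hx : pl x = some y) (hfib : ∀ i, pl i = some y → i = x)
    (hpl : ∀ i s, 0 < s → s < β → dens i s = (pl i).elim 0 fun b => 1 / (s - σ b))
    (Im : (w : List ι) → KZ.IntegralRep w.length)
    (hIm : ∀ w : List ι, w.getLast? ≠ some x →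
      (Im w).domain = {t | (∀ i, 0 < t i ∧ t i < β) ∧ StrictAnti t} ∧
      Set.EqOn (Im w).integrand (fun t => ∏ i, dens (w.get i) (t i)) (Im w).domain)
    (Ia : (w : List κ) → KZ.IntegralRep w.length) (β' : ℝ) (hβ' : β' = β)
    (hIa : ∀ w : List κ, w.getLast? ≠ some y →
      (Ia w).domain = {t | (∀ i, 0 < t i ∧ t i < β') ∧ StrictAnti t} ∧
      Set.EqOn (Ia w).integrand (fun t => ∏ i, 1 / (t i - σ (w.get i))) (Ia w).domain)
    (Pm : NCSeries ι R)
    (hPm : ∀ W, Pm W = if W = [] then 1 else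
      Shuffle.pair (fun w => χ (KZ.of (Im w))) (Shuffle.regEnd x W))
    (Pa : NCSeries κ R)
    (hPa : ∀ W, Pa W = if W = [] then 1 else
      Shuffle.pair (fun w => χ (KZ.of (Ia w))) (Shuffle.regEnd y W))
    (N : ℕ) (v : ι → A) (vκ : κ → A)
    (hv : ∀ b, vκ b = ∑ i ∈ Finset.univ.filter (fun i => pl i = some b), v i) :
    NCSeries.evalTrunc N v Pm = NCSeries.evalTrunc N vκ Pa := by
  subst hβ'
  have hxs : (pl x).isSome := by rw [hx]; rfl
  refine side_transport χ hrel β' dens σ x y Im hIm Ia hIa (L := {i // (pl i).isSome})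
    Subtype.val Subtype.val_injective (fun a => (pl a.1).get a.2) ⟨x, hxs⟩ rfl
    (fun a => ?_) (fun i => ?_) (fun a s hs0 hs1 => ?_) Pm hPm Pa hPa N v vκ fun b => ?_
  · -- the fibre of `y`
    constructor
    · intro h
      have : pl a.1 = some y := by rw [← h]; exact (Option.some_get a.2).symm
      exact Subtype.ext (hfib _ this)
    · rintro rfl
      exact Option.some_injective _ ((Option.some_get hxs).trans hx)
  · cases h : pl i with
    | none => exact Or.inr fun s hs0 hs1 => by rw [hpl i s hs0 hs1, h]; rfl
    | some b => exact Or.inl ⟨⟨i, by rw [h]; rfl⟩, rfl⟩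
  · rw [hpl _ s hs0 hs1]
    have e : pl a.1 = some ((pl a.1).get a.2) := (Option.some_get a.2).symm
    conv_lhs => rw [e]
    rfl
  · rw [hv b, Finset.sum_filter, Finset.sum_filter]
    have key : ∀ a : {i // (pl i).isSome},
        ((pl a.1).get a.2 = b ↔ pl a.1 = some b) := fun a =>
      ⟨fun h => by rw [← h, Option.some_get], fun h => Option.some_injective _ (by
        rw [Option.some_get]; exact h)⟩
    simp only [key]
    rw [← Finset.sum_subtype (Finset.univ.filter fun i : ι => (pl i).isSome) (by simp)
      (fun i => if pl i = some b then v i else 0)]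
    exact (Finset.sum_subset (Finset.filter_subset _ _) fun i _ hi => by
      rw [if_neg]
      intro h
      exact hi (Finset.mem_filter.mpr ⟨Finset.mem_univ _, by rw [h]; rfl⟩)).symm

end Partial

/-! ### The two rows of atlas poles met by the cubical charts -/

/-- Poles `0, 1, 2` (atlas row of path `0`): rational, nonzero off the letter `0`, separated from
`(0, 1/2)`. [folklore] -/
theorem poles_012 :
    (∀ b : Fin 3, ∃ q : ℚ, (![0, 1, 2] : Fin 3 → ℝ) b = q) ∧
    (∀ b : Fin 3, b ≠ 0 → (![0, 1, 2] : Fin 3 → ℝ) b ≠ 0) ∧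
    (∀ b : Fin 3, (![0, 1, 2] : Fin 3 → ℝ) b = 0 ∨
      ∀ s : ℝ, 0 < s → s < ((1 / 2 : ℚ) : ℝ) → 2⁻¹ ≤ |s - (![0, 1, 2] : Fin 3 → ℝ) b|) := by
  have h1 := PathFamilies.shift_rat 0
  have h2 := PathFamilies.shift_ne_zero 0
  have h3 := PathFamilies.shift_sep 0
  simp only [Matrix.cons_val_zero] at h1 h2 h3
  rw [show (1 / 2 : ℝ) = ((1 / 2 : ℚ) : ℝ) by norm_num] at h3
  exact ⟨h1, h2, h3⟩

/-- Poles `0, 1, -1` (atlas row of path `1`): rational, nonzero off the letter `0`, separated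
from `(0, 1/2)`. [folklore] -/
theorem poles_01m :
    (∀ b : Fin 3, ∃ q : ℚ, (![0, 1, -1] : Fin 3 → ℝ) b = q) ∧
    (∀ b : Fin 3, b ≠ 0 → (![0, 1, -1] : Fin 3 → ℝ) b ≠ 0) ∧
    (∀ b : Fin 3, (![0, 1, -1] : Fin 3 → ℝ) b = 0 ∨
      ∀ s : ℝ, 0 < s → s < ((1 / 2 : ℚ) : ℝ) → 2⁻¹ ≤ |s - (![0, 1, -1] : Fin 3 → ℝ) b|) := by
  have h1 := PathFamilies.shift_rat 1
  have h2 := PathFamilies.shift_ne_zero 1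
  have h3 := PathFamilies.shift_sep 1
  simp only [Matrix.cons_val_one] at h1 h2 h3
  rw [show (1 / 2 : ℝ) = ((1 / 2 : ℚ) : ℝ) by norm_num] at h3
  exact ⟨h1, h2, h3⟩

end CornersCubical

/-- **Sub-stub `cornersCubical_sideFamily` of `stub_cornersCubical`**: existence of the family
of KZ representations of a side of a corner chart whose letter densities are `0` (dead letters)
or atlas densities `1/(t - σ b)` with rational poles `0`-or-separated from `(0, β)`, pole `0`
only over the regularised letter. [cite: KontsevichZagier2001, §1.1] -/
theorem cornersCubical_sideFamily :
    ∀ (ι κ : Type) (β : ℝ), (∃ q : ℚ, β = q) → β ≤ 1 → ∀ (σ : κ → ℝ) (y : κ), (∀ b, ∃ q : ℚ, σ b = q) → (∀ b, b ≠ y → σ b ≠ 0) → (∀ b, σ b = 0 ∨ ∀ s : ℝ, 0 < s → s < β → 2⁻¹ ≤ |s - σ b|) → ∀ (dens : ι → ℝ → ℝ) (pl : ι → Option κ) (x : ι), (∀ i, pl i = some y → i = x) → (∀ (i : ι) (s : ℝ), 0 < s → s < β → dens i s = (pl i).elim 0 fun b => 1 / (s - σ b)) → ∃ I : (w : List ι)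 → KZ.IntegralRep w.length, ∀ w : List ι, w.getLast? ≠ some x → (I w).domain = {t | (∀ i, 0 < t i ∧ t i < β) ∧ StrictAnti t} ∧ Set.EqOn (I w).integrand (fun t => ∏ i, dens (w.get i) (t i)) (I w).domain := by
  intro ι κ β hβq hβ1 σ y hσq hσ0 hsep dens pl x hfib hpl
  exact CornersCubical.exists_sideFamily β hβq hβ1 σ y hσq hσ0 hsep dens pl x hfib hpl

end Summit.KontsevichZagierPeriods.FurushoPentagon.PentagonInKZ
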